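import Summits.CriticalPhenomena.CardyFormulaZ2.Theses.CardyBoundaryCoulombGas
import Summits.CriticalPhenomena.CardyFormulaZ2.Theorems.CardyBoundaryCoulombGasStripClusterRatesIterateAverage
import Literature.Probability.LatticeModels.RowStatePlanar
import Literature.Probability.Percolation.LatticeSymmetry
import Literature.LinearAlgebra.Matrix.PerronFrobeniusIrreducibleProofs

/-!
# Stub `stub_oneClusterSpectral` (S1') of the line `two-cluster-rate-is-stationary-gap`
# (crux `CardyBoundaryCoulombGas.StripClusterRates`, stmt-CriticalPhenomena-13878)

ONE-CLUSTER RATE = ESCAPE RATE, the spectral step. Let `S = {0,…,n}`, `T = planarTransfer S` (the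
stochastic `⋆`-chain of one row step of bond percolation at `p = 1/2` on planar connectivity
patterns, `RowStatePlanar.lean`) and call a pattern MARKED when some site is joined to `⋆`.
Assuming the one-cluster dictionary D1 (`crossingProb half m n` = fraction of admissible bond words
of length `m` whose iterate from `wired` is marked) and marked reachability D2 (every planar marked
pattern is an iterate of `wired`), we prove: the rate `γ₁(n) = lim -log p₁(m,n)/m` exists and
`e^{-γ₁(n)}` is the Perron root of the MARKED BLOCK of `T`, in the inlined eigenpair language of the
skeleton (an eigenpair of modulus `e^{-γ₁}` supported on marked patterns exists, and every such
eigenpair has modulus `≤ e^{-γ₁}`).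

Steps. (1) Block structure (shared helper file `…IterateAverage`): `T u q = 0` for `u` unmarked,
`q` marked, so the powers of the marked block `M = T.submatrix val val` are the marked entries of
the powers of `T` (`s1_markedBlock_pow_apply`). (2) `M` is irreducible
(`s1_markedBlock_irreducible`): a marked pattern reaches `wired` in ONE step (all bonds open; in
`{0,…,n}` consecutive sites are chained by `hEdges`, `s1_sup_hEdgeRel_inl_inl`), `wired` reaches
every marked pattern by D2, and a word gives a positive power entry. (3) Perron–Frobenius
(`Literature.LinearAlgebra.Matrix.DingZhou2009_thm_2_6_holds`, PROVED in the tree): `r > 0`,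
`x > 0`, `M x = r x`, and `‖μ‖ ≤ r` for complex eigenpairs of `M`. (4) The zero-extension `x̃` of
`x` has `T x̃ = r x̃` (`s1_mulVec_extend`); by the counting form of `T^m`
(`s1_pow_planarTransfer_mulVec`) `∑_{words} x̃(iterate from wired) = N^m r^m x̃(wired)`, whence
`(x_w/max x) r^m ≤ p₁(m,n) ≤ (x_w/min x) r^m` and `-log p₁(m,n)/m → -log r =: γ₁`
(`s1_tendsto_rate_of_two_sided`). (5) `(r, x̃)` is a skeleton eigenpair of modulus `r = e^{-γ₁}`;
a skeleton eigenpair restricts to a complex eigenpair of `M`, so `‖μ‖ ≤ r`.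

Sources: Bondesan–Jacobsen–Saleur, Nucl. Phys. B 867 (2013) §2, §5.1; Cardy, arXiv:math-ph/0103018
§7.1; Ding–Zhou, *Nonnegative Matrices, Positive Operators, and Applications* (2009) Thm 2.6.
-/

noncomputable section

namespace Summit.CriticalPhenomena.CardyFormulaZ2.Cruxes.StripClusterRates.TwoClusterRateIsStationaryGap

open Filter Topology
open scoped BigOperators Classical Matrix
open Literature.Probability.Percolation Literature.Probability.LatticeModels

/-! ## §1 The marked block and its powers -/

/-- **Powers of the marked block are the marked entries of the powers of `T`** (the matrix is
block upper-triangular for the decomposition marked ⊕ unmarked). [folklore] -/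
theorem s1_markedBlock_pow_apply (S : Finset ℤ) (k : ℕ)
    (a b : {p : PlanarRowState S // ∃ x, p.1.JoinedToStar x}) :
    ((planarTransfer S).submatrix
        (Subtype.val : {p : PlanarRowState S // ∃ x, p.1.JoinedToStar x} → PlanarRowState S)
        (Subtype.val : {p : PlanarRowState S // ∃ x, p.1.JoinedToStar x} → PlanarRowState S) ^ k)
        a b = (planarTransfer S ^ k) a.1 b.1 := by
  induction k generalizing b with
  | zero =>
    rw [pow_zero, pow_zero]
    by_cases h : a = b
    · subst h
      rw [Matrix.one_apply_eq, Matrix.one_apply_eq]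
    · have h' : a.1 ≠ b.1 := fun e => h (Subtype.ext e)
      rw [Matrix.one_apply_ne h, Matrix.one_apply_ne h']
  | succ k ih =>
    rw [pow_succ, pow_succ, Matrix.mul_apply, Matrix.mul_apply,
      ← Fintype.sum_subtype_add_sum_subtype (fun p : PlanarRowState S => ∃ x, p.1.JoinedToStar x)
        (fun q => (planarTransfer S ^ k) a.1 q * planarTransfer S q b.1)]
    have h0 : ∑ c : {p : PlanarRowState S // ¬ ∃ x, p.1.JoinedToStar x},
        (planarTransfer S ^ k) a.1 c.1 * planarTransfer S c.1 b.1 = 0 :=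
      Finset.sum_eq_zero fun c _ => by
        rw [s1_planarTransfer_eq_zero_of_not_joinedToStar c.1 b.1 (not_exists.1 c.2) b.2, mul_zero]
    rw [h0, add_zero]
    refine Finset.sum_congr rfl fun c _ => ?_
    rw [ih c, Matrix.submatrix_apply]

/-! ## §2 Irreducibility of the marked block on `{0,…,n}` -/

/-- In the column set `{0,…,n}` consecutive sites are the edges of `hEdges`, so opening every
horizontal edge joins any two sites. [folklore] -/
theorem s1_sup_hEdgeRel_inl_inl (n : ℕ) (x y : ((Finset.Icc (0 : ℤ) n : Finset ℤ) : Type)) :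
    ((hEdges (Finset.Icc (0 : ℤ) n)).sup hEdgeRel) (Sum.inl x) (Sum.inl y) := by
  have h0 : (0 : ℤ) ∈ Finset.Icc (0 : ℤ) n := Finset.mem_Icc.2 ⟨le_rfl, Nat.cast_nonneg n⟩
  have key : ∀ (k : ℕ) (z : ((Finset.Icc (0 : ℤ) n : Finset ℤ) : Type)), (z : ℤ) = k →
      ((hEdges (Finset.Icc (0 : ℤ) n)).sup hEdgeRel) (Sum.inl ⟨0, h0⟩) (Sum.inl z) := by
    intro k
    induction k with
    | zero =>
      rintro ⟨z, hzm⟩ hz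
      simp only [Nat.cast_zero] at hz
      subst hz
      exact Setoid.refl' _ _
    | succ k ih =>
      rintro ⟨z, hzm⟩ hz
      push_cast at hz
      subst hz
      have hk' : (k : ℤ) ∈ Finset.Icc (0 : ℤ) n := by
        rw [Finset.mem_Icc] at hzm ⊢
        omega
      have hmem : (⟨k, hk'⟩ : ((Finset.Icc (0 : ℤ) n : Finset ℤ) : Type)) ∈
          hEdges (Finset.Icc (0 : ℤ) n) :=
        (mem_hEdges _).2 hzm
      exact Setoid.trans' _ (ih ⟨k, hk'⟩ rfl)
        (Finset.le_sup (f := hEdgeRel) hmem (hEdgeRel_rel _ hzm))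
  have hx := key (x : ℤ).toNat x (Int.toNat_of_nonneg (Finset.mem_Icc.1 x.2).1).symm
  have hy := key (y : ℤ).toNat y (Int.toNat_of_nonneg (Finset.mem_Icc.1 y.2).1).symm
  exact Setoid.trans' _ (Setoid.symm' _ hx) hy

/-- **A marked pattern of `{0,…,n}` reaches `wired` in one step**: open every bond (the vertical
layer copies the pattern, the horizontal layer merges all sites into the class of the site joined
to `⋆`). [folklore] -/
theorem s1_planarRowStep_univ_hEdges (n : ℕ) (p : PlanarRowState (Finset.Icc (0 : ℤ) n))
    (hp : ∃ x, p.1.JoinedToStar x) :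
    planarRowStep Finset.univ (hEdges (Finset.Icc (0 : ℤ) n)) p =
      PlanarRowState.wired (Finset.Icc (0 : ℤ) n) := by
  obtain ⟨x0, hx0⟩ := hp
  apply Subtype.ext
  apply RowState.ext
  show horizRel (hEdges _) (vertRel Finset.univ p.1.rel) = (⊤ : Setoid _)
  rw [vertRel_univ, horizRel, eq_top_iff, Setoid.le_def]
  intro a b _
  have hJ : (hEdges (Finset.Icc (0 : ℤ) n)).sup hEdgeRel ≤
      p.1.rel ⊔ (hEdges (Finset.Icc (0 : ℤ) n)).sup hEdgeRel := le_sup_right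
  have hsite : ∀ x : ((Finset.Icc (0 : ℤ) n : Finset ℤ) : Type),
      (p.1.rel ⊔ (hEdges _).sup hEdgeRel) (Sum.inl x) (RowPoint.star _) := fun x =>
    Setoid.trans' _ (hJ (s1_sup_hEdgeRel_inl_inl n x x0)) ((le_sup_left : p.1.rel ≤ _) hx0)
  rcases a with x | ⟨⟩ <;> rcases b with y | ⟨⟩
  · exact hJ (s1_sup_hEdgeRel_inl_inl n x y)
  · exact hsite x
  · exact Setoid.symm' _ (hsite y)
  · exact Setoid.refl' _ _

/-- **Irreducibility of the marked block** (path form `∀ a b, ∃ k > 0, 0 < (M^k) a b`), from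
marked reachability D2: `a → wired` in one step, then `wired → b` along D2's word with the
horizontal labels normalised to `hEdges`. [folklore] -/
theorem s1_markedBlock_irreducible (n : ℕ)
    (hD2 : ∀ q : PlanarRowState (Finset.Icc (0 : ℤ) n), (∃ x, q.1.JoinedToStar x) →
      ∃ l : List (Finset (Finset.Icc (0 : ℤ) n) × Finset (Finset.Icc (0 : ℤ) n)),
        l.foldl (fun r OH => planarRowStep OH.1 OH.2 r) (PlanarRowState.wired (Finset.Icc (0 : ℤ) n)) = q)
    (a b : {p : PlanarRowState (Finset.Icc (0 : ℤ) n) // ∃ x, p.1.JoinedToStar x}) :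
    ∃ k : ℕ, 0 < k ∧ 0 <
      ((planarTransfer (Finset.Icc (0 : ℤ) n)).submatrix
        (Subtype.val : {p : PlanarRowState (Finset.Icc (0 : ℤ) n) // ∃ x, p.1.JoinedToStar x} →
          PlanarRowState (Finset.Icc (0 : ℤ) n))
        (Subtype.val : {p : PlanarRowState (Finset.Icc (0 : ℤ) n) // ∃ x, p.1.JoinedToStar x} →
          PlanarRowState (Finset.Icc (0 : ℤ) n)) ^ k) a b := by
  obtain ⟨l, hl⟩ := hD2 b.1 b.2
  -- the normalised word: all bonds open first, then D2's word with `H ↦ H ∩ hEdges`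
  let g : Finset (Finset.Icc (0 : ℤ) n) × Finset (Finset.Icc (0 : ℤ) n) →
      Finset (Finset.Icc (0 : ℤ) n) × Finset (Finset.Icc (0 : ℤ) n) :=
    fun OH => (OH.1, OH.2 ∩ hEdges (Finset.Icc (0 : ℤ) n))
  let L : List (Finset (Finset.Icc (0 : ℤ) n) × Finset (Finset.Icc (0 : ℤ) n)) :=
    (Finset.univ, hEdges (Finset.Icc (0 : ℤ) n)) :: l.map g
  refine ⟨L.length, by simp [L], ?_⟩
  rw [s1_markedBlock_pow_apply]
  refine s1_pow_planarTransfer_pos_of_foldl _ L.length a.1 b.1 L.get (fun t => ?_) ?_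
  · rcases List.mem_cons.1 (List.get_mem L t) with h | h
    · rw [h]
    · obtain ⟨OH, -, hOH⟩ := List.mem_map.1 h
      rw [← hOH]
      exact Finset.inter_subset_right
  · rw [List.ofFn_get, List.foldl_cons, List.foldl_map]
    change List.foldl (fun r OH => planarRowStep (g OH).1 (g OH).2 r)
      (planarRowStep Finset.univ (hEdges (Finset.Icc (0 : ℤ) n)) a.1) l = b.1
    rw [s1_planarRowStep_univ_hEdges n a.1 a.2, ← hl]
    congr 1
    funext r OH
    exact s1_planarRowStep_inter_hEdges _ OH.1 OH.2 r

/-! ## §3 Eigenvectors of the marked block and of the full matrix -/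

/-- **Zero-extension of a block eigenvector**: if `M x = r x` for the marked block `M`, then the
extension of `x` by `0` to unmarked patterns is an eigenvector of the full matrix `T` with the same
eigenvalue (the unmarked rows of `T` do not see marked columns). [folklore] -/
theorem s1_mulVec_extend {S : Finset ℤ} (r : ℝ)
    (x : {p : PlanarRowState S // ∃ y, p.1.JoinedToStar y} → ℝ)
    (hx : (planarTransfer S).submatrix
        (Subtype.val : {p : PlanarRowState S // ∃ y, p.1.JoinedToStar y} → PlanarRowState S)
        (Subtype.val : {p : PlanarRowState S // ∃ y, p.1.JoinedToStar y} → PlanarRowState S) *ᵥ x =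
      r • x) :
    planarTransfer S *ᵥ (fun q => if h : ∃ y, q.1.JoinedToStar y then x ⟨q, h⟩ else 0) =
      r • (fun q => if h : ∃ y, q.1.JoinedToStar y then x ⟨q, h⟩ else 0) := by
  funext p
  rw [Pi.smul_apply, smul_eq_mul]
  simp only [Matrix.mulVec, dotProduct]
  rw [← Fintype.sum_subtype_add_sum_subtype (fun q : PlanarRowState S => ∃ y, q.1.JoinedToStar y)]
  have h0 : ∑ c : {q : PlanarRowState S // ¬ ∃ y, q.1.JoinedToStar y},
      planarTransfer S p c.1 * (if h : ∃ y, c.1.1.JoinedToStar y then x ⟨c.1, h⟩ else 0) = 0 :=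
    Finset.sum_eq_zero fun c _ => by rw [dif_neg c.2, mul_zero]
  rw [h0, add_zero]
  have h1 : ∀ b : {q : PlanarRowState S // ∃ y, q.1.JoinedToStar y},
      (if h : ∃ y, b.1.1.JoinedToStar y then x ⟨b.1, h⟩ else 0) = x b := fun b => by
    rw [dif_pos b.2]
  simp_rw [h1]
  by_cases hp : ∃ y, p.1.JoinedToStar y
  · rw [dif_pos hp]
    have h2 := congrFun hx ⟨p, hp⟩
    rw [Pi.smul_apply, smul_eq_mul] at h2
    rw [← h2]
    simp only [Matrix.mulVec, dotProduct, Matrix.submatrix_apply]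
  · rw [dif_neg hp, mul_zero]
    exact Finset.sum_eq_zero fun b _ => by
      rw [s1_planarTransfer_eq_zero_of_not_joinedToStar p b.1 (not_exists.1 hp) b.2, zero_mul]

/-! ## §4 Rates from two-sided geometric bounds -/

/-- **Rate from a two-sided geometric bound**: if `c s^m ≤ a m ≤ C s^m` with `c, s > 0`, then
`-log (a m) / m → -log s`. [folklore] -/
theorem s1_tendsto_rate_of_two_sided {a : ℕ → ℝ} {s c C : ℝ} (hs : 0 < s) (hc : 0 < c)
    (hlow : ∀ m, c * s ^ m ≤ a m) (hup : ∀ m, a m ≤ C * s ^ m) :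
    Tendsto (fun m : ℕ => -Real.log (a m) / (m : ℝ)) atTop (𝓝 (-Real.log s)) := by
  have ha : ∀ m, 0 < a m := fun m => (mul_pos hc (pow_pos hs m)).trans_le (hlow m)
  have hC : 0 < C := by
    have h0 := (ha 0).trans_le (hup 0)
    simpa using h0
  have hlim : ∀ k : ℝ, Tendsto (fun m : ℕ => -Real.log s - k / (m : ℝ)) atTop (𝓝 (-Real.log s)) := by
    intro k
    have h := tendsto_const_nhds (x := -Real.log s).sub (tendsto_const_div_atTop_nhds_zero_nat k)
    rwa [sub_zero] at h
  refine tendsto_of_tendsto_of_tendsto_of_le_of_le' (hlim (Real.log C)) (hlim (Real.log c)) ?_ ?_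
  · filter_upwards [eventually_ge_atTop 1] with m hm
    have hm0 : (0 : ℝ) < m := by exact_mod_cast hm
    have h1 := Real.log_le_log (ha m) (hup m)
    rw [Real.log_mul hC.ne' (pow_ne_zero _ hs.ne'), Real.log_pow] at h1
    rw [show -Real.log s - Real.log C / m = (-Real.log s * m - Real.log C) / m by field_simp]
    exact div_le_div_of_nonneg_right (by linarith) hm0.le
  · filter_upwards [eventually_ge_atTop 1] with m hm
    have hm0 : (0 : ℝ) < m := by exact_mod_cast hm
    have h1 := Real.log_le_log (mul_pos hc (pow_pos hs m)) (hlow m)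
    rw [Real.log_mul hc.ne' (pow_ne_zero _ hs.ne'), Real.log_pow] at h1
    rw [show -Real.log s - Real.log c / m = (-Real.log s * m - Real.log c) / m by field_simp]
    exact div_le_div_of_nonneg_right (by linarith) hm0.le

/-! ## §5 The stub -/

/-- **S1' · ONE-CLUSTER SPECTRAL STEP** (`= OneClusterSpectral` of the line skeleton): from the
one-cluster dictionary D1 and marked reachability D2, for every width `n ≥ 1` the one-cluster rate
`γ₁(n) = lim -log (crossingProb half m n)/m` exists and `e^{-γ₁(n)}` is the Perron root of the
marked block of `planarTransfer {0,…,n}` — there is a marked-block eigenpair of modulus `e^{-γ₁(n)}`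
and every marked-block eigenpair has modulus `≤ e^{-γ₁(n)}` (Perron–Frobenius for the irreducible
marked block, `DingZhou2009_thm_2_6_holds`, and the squeeze `c r^m ≤ p₁(m,n) ≤ C r^m`). The
hypothesis `1 ≤ n` is not used. [folklore] -/
theorem stub_oneClusterSpectral :
    (∀ m n : ℕ, crossingProb half m n =
      ((((Fintype.piFinset fun _ : Fin m =>
            (Finset.univ : Finset (Finset (Finset.Icc (0 : ℤ) n))) ×ˢ (hEdges (Finset.Icc (0 : ℤ) n)).powerset).filter
          fun seq => ∃ x, ((List.ofFn seq).foldl (fun r OH => planarRowStep OH.1 OH.2 r)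
            (PlanarRowState.wired (Finset.Icc (0 : ℤ) n))).1.JoinedToStar x).card : ℝ) /
        ((2 : ℝ) ^ (Finset.Icc (0 : ℤ) n).card * 2 ^ (hEdges (Finset.Icc (0 : ℤ) n)).card) ^ m)) →
    (∀ (n : ℕ) (q : PlanarRowState (Finset.Icc (0 : ℤ) n)), (∃ x, q.1.JoinedToStar x) →
      ∃ l : List (Finset (Finset.Icc (0 : ℤ) n) × Finset (Finset.Icc (0 : ℤ) n)),
        l.foldl (fun r OH => planarRowStep OH.1 OH.2 r) (PlanarRowState.wired (Finset.Icc (0 : ℤ) n)) = q) →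
    ∀ n : ℕ, 1 ≤ n → ∃ γ : ℝ,
      Tendsto (fun m : ℕ ↦ -Real.log (crossingProb half m n) / (m : ℝ)) atTop (𝓝 γ) ∧
      ((∃ (μ : ℂ) (v : PlanarRowState (Finset.Icc (0 : ℤ) n) → ℂ),
          (v ≠ 0 ∧ (∀ p, (∀ x, ¬ p.1.JoinedToStar x) → v p = 0) ∧
            ∀ p, (∃ x, p.1.JoinedToStar x) →
              ∑ q, (planarTransfer (Finset.Icc (0 : ℤ) n) p q : ℂ) * v q = μ * v p) ∧
          ‖μ‖ = Real.exp (-γ)) ∧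
        ∀ (μ : ℂ) (v : PlanarRowState (Finset.Icc (0 : ℤ) n) → ℂ),
          (v ≠ 0 ∧ (∀ p, (∀ x, ¬ p.1.JoinedToStar x) → v p = 0) ∧
            ∀ p, (∃ x, p.1.JoinedToStar x) →
              ∑ q, (planarTransfer (Finset.Icc (0 : ℤ) n) p q : ℂ) * v q = μ * v p) →
          ‖μ‖ ≤ Real.exp (-γ)) := by
  intro hD1 hD2 n _
  have h0S : (0 : ℤ) ∈ Finset.Icc (0 : ℤ) n := Finset.mem_Icc.2 ⟨le_rfl, Nat.cast_nonneg n⟩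
  -- the marked block `M` and its index type
  haveI : Nonempty {p : PlanarRowState (Finset.Icc (0 : ℤ) n) // ∃ x, p.1.JoinedToStar x} :=
    ⟨⟨PlanarRowState.wired _, ⟨0, h0S⟩, s1_joinedToStar_wired _⟩⟩
  -- Perron–Frobenius for the irreducible nonnegative marked block
  obtain ⟨r, hr, x, y, hxpos, -, hMx, -, hdom, -, -, -⟩ :=
    Literature.LinearAlgebra.Matrix.DingZhou2009_thm_2_6_holds
      {p : PlanarRowState (Finset.Icc (0 : ℤ) n) // ∃ x, p.1.JoinedToStar x}
      ((planarTransfer (Finset.Icc (0 : ℤ) n)).submatrix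
        (Subtype.val : {p : PlanarRowState (Finset.Icc (0 : ℤ) n) // ∃ x, p.1.JoinedToStar x} →
          PlanarRowState (Finset.Icc (0 : ℤ) n))
        (Subtype.val : {p : PlanarRowState (Finset.Icc (0 : ℤ) n) // ∃ x, p.1.JoinedToStar x} →
          PlanarRowState (Finset.Icc (0 : ℤ) n)))
      (fun a b => s1_planarTransfer_nonneg _ a.1 b.1)
      (fun a b => s1_markedBlock_irreducible n (hD2 n) a b)
  -- the zero-extension of the Perron vector is an eigenvector of `T`
  set xt : PlanarRowState (Finset.Icc (0 : ℤ) n) → ℝ :=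
    fun q => if h : ∃ z, q.1.JoinedToStar z then x ⟨q, h⟩ else 0 with hxt
  have hText : planarTransfer (Finset.Icc (0 : ℤ) n) *ᵥ xt = r • xt := s1_mulVec_extend r x hMx
  have hxt_pos : ∀ (q : PlanarRowState (Finset.Icc (0 : ℤ) n)) (hq : ∃ z, q.1.JoinedToStar z),
      xt q = x ⟨q, hq⟩ := fun q hq => by rw [hxt]; exact dif_pos hq
  have hxt_zero : ∀ q : PlanarRowState (Finset.Icc (0 : ℤ) n), (∀ z, ¬ q.1.JoinedToStar z) →
      xt q = 0 := fun q hq => by rw [hxt]; exact dif_neg (not_exists.2 hq)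
  -- the wired index and the extreme entries of `x`
  set w : {p : PlanarRowState (Finset.Icc (0 : ℤ) n) // ∃ x, p.1.JoinedToStar x} :=
    ⟨PlanarRowState.wired _, ⟨0, h0S⟩, s1_joinedToStar_wired _⟩ with hw
  have hxtw : xt (PlanarRowState.wired _) = x w := hxt_pos _ _
  obtain ⟨imin, hmin⟩ := Finite.exists_min x
  obtain ⟨imax, hmax⟩ := Finite.exists_max x
  -- two-sided geometric bounds for `p₁(m,n)`
  have key : ∀ m : ℕ, x w / x imax * r ^ m ≤ crossingProb half m n ∧
      crossingProb half m n ≤ x w / x imin * r ^ m := by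
    intro m
    rw [hD1 m n]
    have hNpos : (0 : ℝ) <
        ((2 : ℝ) ^ (Finset.Icc (0 : ℤ) n).card * 2 ^ (hEdges (Finset.Icc (0 : ℤ) n)).card) ^ m := by
      positivity
    -- `∑_{words} xt (iterate) = r^m x_w N^m`
    have h1 : (planarTransfer _ ^ m *ᵥ xt) (PlanarRowState.wired (Finset.Icc (0 : ℤ) n)) =
        r ^ m * x w := by
      rw [Literature.LinearAlgebra.Matrix.DingZhouPF.pow_mulVec_of_eq hText m, Pi.smul_apply,
        smul_eq_mul, hxtw]
    have h2 := s1_pow_planarTransfer_mulVec (Finset.Icc (0 : ℤ) n) m xt (PlanarRowState.wired _)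
    rw [h1, eq_div_iff hNpos.ne'] at h2
    -- only marked iterates contribute, each between `min x` and `max x`
    obtain ⟨hlow, hup⟩ := s1_card_filter_bounds h2.symm
      (fun seq : Fin m → Finset (Finset.Icc (0 : ℤ) n) × Finset (Finset.Icc (0 : ℤ) n) =>
        ∃ z, ((List.ofFn seq).foldl (fun r OH => planarRowStep OH.1 OH.2 r)
          (PlanarRowState.wired (Finset.Icc (0 : ℤ) n))).1.JoinedToStar z)
      (x imin) (x imax)
      (fun seq _ hq => hxt_zero _ (not_exists.1 hq))
      (fun seq _ hq => by rw [hxt_pos _ hq]; exact hmin _)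
      (fun seq _ hq => by rw [hxt_pos _ hq]; exact hmax _)
    constructor
    · rw [div_mul_eq_mul_div, div_le_div_iff₀ (hxpos imax) hNpos]
      linarith
    · rw [div_mul_eq_mul_div, div_le_div_iff₀ hNpos (hxpos imin)]
      linarith
  have hc : 0 < x w / x imax := div_pos (hxpos w) (hxpos imax)
  refine ⟨-Real.log r, ?_, ?_, ?_⟩
  · -- the rate
    exact s1_tendsto_rate_of_two_sided hr hc (fun m => (key m).1) (fun m => (key m).2)
  · -- the Perron eigenpair `(r, xt)` of the marked block, modulus `r = e^{-γ}`
    rw [neg_neg, Real.exp_log hr]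
    refine ⟨(r : ℂ), fun q => ((xt q : ℝ) : ℂ), ⟨?_, ?_, ?_⟩, Complex.norm_of_nonneg hr.le⟩
    · intro hv
      have h := congrFun hv (PlanarRowState.wired _)
      rw [Pi.zero_apply, Complex.ofReal_eq_zero, hxtw] at h
      exact (hxpos w).ne' h
    · intro p hp
      beta_reduce
      rw [hxt_zero p hp, Complex.ofReal_zero]
    · intro p _
      have h := congrFun hText p
      rw [Pi.smul_apply, smul_eq_mul] at h
      simp only [Matrix.mulVec, dotProduct] at h
      beta_reduce
      exact_mod_cast h
  · -- domination: a marked-block eigenpair restricts to a complex eigenpair of `M`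
    rw [neg_neg, Real.exp_log hr]
    rintro μ v ⟨hv0, hvan, heq⟩
    refine hdom μ (fun b => v b.1) ?_ ?_
    · intro h
      apply hv0
      funext q
      by_cases hq : ∃ z, q.1.JoinedToStar z
      · exact congrFun h ⟨q, hq⟩
      · exact hvan q (not_exists.1 hq)
    · funext a
      rw [Pi.smul_apply, smul_eq_mul, ← heq a.1 a.2]
      simp only [Matrix.mulVec, dotProduct, Matrix.map_apply, Matrix.submatrix_apply,
        Complex.coe_algebraMap]
      rw [← Fintype.sum_subtype_add_sum_subtype
        (fun q : PlanarRowState (Finset.Icc (0 : ℤ) n) => ∃ z, q.1.JoinedToStar z)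
        (fun q => (planarTransfer (Finset.Icc (0 : ℤ) n) a.1 q : ℂ) * v q)]
      have h0 : ∑ c : {q : PlanarRowState (Finset.Icc (0 : ℤ) n) // ¬ ∃ z, q.1.JoinedToStar z},
          (planarTransfer (Finset.Icc (0 : ℤ) n) a.1 c.1 : ℂ) * v c.1 = 0 :=
        Finset.sum_eq_zero fun c _ => by rw [hvan c.1 (not_exists.1 c.2), mul_zero]
      rw [h0, add_zero]

end Summit.CriticalPhenomena.CardyFormulaZ2.Cruxes.StripClusterRates.TwoClusterRateIsStationaryGap

end
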